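import Mathlib.Data.Real.Basic
import Mathlib.Data.Fin.Basic
import HarnessLib

/-!
# K2R `RealisedQuasiStaticCellLaw`, line `floquet-bloch`, stub `stub_lowSectorWeakNear`: the co-moving coefficient sequences
# exist (helper; `--supports stmt-AnomalousDissipation-20446`)

Summits-side helper file (everything proved; no definitions, no named facts). The hypotheses `hC0` / `hCsucc` of
`comoving_start` / `comoving_junc` / `comoving_end` (p584793) ask for four real sequences `c₁₁ c₁₂ c₂₁ c₂₂ : ℕ → ℝ` with
`c(0) = 1` (identity) and `c(j+1) = c(j)·S_j` for `j < k₀`, where `S_j = [[A_j, B_j], [B_j, D_j]]` is the symmetric per-slot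
transport (`A_j = rc_j²e^{X_o,j} + rs_j²e^{X_i,j}`, `B_j = rc_j rs_j (e^{X_o,j} − e^{X_i,j})`, `D_j = rs_j²e^{X_o,j} + rc_j²e^{X_i,j}`).
`comoving_cseq_exists` constructs them by recursion on `ℕ` for arbitrary `A B D : Fin k₀ → ℝ`.
-/

set_option linter.dupNamespace false

namespace Summit.AnomalousDissipation.AnomalousDissipation.Theorems.SolenoidalFractalHomogenisation.RealisedQuasiStaticCellLaw

/-- **The co-moving coefficient sequences exist** (row recursion `c(j+1) = c(j)·[[A,B],[B,D]]_j`, `c(0) = 1`). -/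
theorem comoving_cseq_exists {k₀ : ℕ} (A B D : Fin k₀ → ℝ) :
    ∃ c₁₁ c₁₂ c₂₁ c₂₂ : ℕ → ℝ, (c₁₁ 0 = 1 ∧ c₁₂ 0 = 0 ∧ c₂₁ 0 = 0 ∧ c₂₂ 0 = 1) ∧
      ∀ j : Fin k₀,
        c₁₁ ((j : ℕ) + 1) = c₁₁ j * A j + c₁₂ j * B j ∧ c₁₂ ((j : ℕ) + 1) = c₁₁ j * B j + c₁₂ j * D j ∧
        c₂₁ ((j : ℕ) + 1) = c₂₁ j * A j + c₂₂ j * B j ∧ c₂₂ ((j : ℕ) + 1) = c₂₁ j * B j + c₂₂ j * D j := by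
  classical
  -- extend the slot data to `ℕ`
  let A' : ℕ → ℝ := fun i => if h : i < k₀ then A ⟨i, h⟩ else 0
  let B' : ℕ → ℝ := fun i => if h : i < k₀ then B ⟨i, h⟩ else 0
  let D' : ℕ → ℝ := fun i => if h : i < k₀ then D ⟨i, h⟩ else 0
  -- one row of the product, started from `v`
  let row : ℝ × ℝ → ℕ → ℝ × ℝ := fun v i =>
    Nat.rec v (fun i w => (w.1 * A' i + w.2 * B' i, w.1 * B' i + w.2 * D' i)) i
  have hrow0 : ∀ v, row v 0 = v := fun v => rfl
  have hrowS : ∀ v i, row v (i + 1) = ((row v i).1 * A' i + (row v i).2 * B' i,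
      (row v i).1 * B' i + (row v i).2 * D' i) := fun v i => rfl
  have hA : ∀ j : Fin k₀, A' j = A j := fun j => by simp [A', j.isLt]
  have hB : ∀ j : Fin k₀, B' j = B j := fun j => by simp [B', j.isLt]
  have hD : ∀ j : Fin k₀, D' j = D j := fun j => by simp [D', j.isLt]
  refine ⟨fun i => (row (1, 0) i).1, fun i => (row (1, 0) i).2, fun i => (row (0, 1) i).1, fun i => (row (0, 1) i).2,
    ⟨by simp [hrow0], by simp [hrow0], by simp [hrow0], by simp [hrow0]⟩, fun j => ⟨?_, ?_, ?_, ?_⟩⟩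
  · simp only [hrowS, hA, hB]
  · simp only [hrowS, hB, hD]
  · simp only [hrowS, hA, hB]
  · simp only [hrowS, hB, hD]

end Summit.AnomalousDissipation.AnomalousDissipation.Theorems.SolenoidalFractalHomogenisation.RealisedQuasiStaticCellLaw
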